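import Summits.QuantumAdvantage.QuantumAdvantage.Theorems.CubicStability.Negative.P4Facts

/-!
# Refutation of `CubicForrelation.CubicStability` (stmt-QuantumAdvantage-2202)

The crux asserts: for even `n` and cubic `f, g` with `Φ(f,g) ≥ 3/5` there is an EXACTLY
forrelated cubic pair `(f₀, g₀)` (`Φ = 1`) within relative Hamming distance `1/4` of `(f, g)` on both
sides.  It is false at `n = 12`.

**Witness `P₄`.**  Group the 12 coordinates into 4 blocks of 3 and put
`b(x) = ∑_k x^k₁ x^k₂ x^k₃` (four disjoint cubes), `a(x) = ∑_k [wt(x^k) = 2]`; both have ANF degree 3.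
Per block, `W_{c₃} = (6; ∓2)` and `(-1)^{[wt = 2]}` is exactly its sign pattern, so
`Φ = (20 / 2^{9/2})^4 = 160000 / 2^18 = 625/1024 ≥ 3/5` (YES).  But NO bent function on `𝔽₂¹²` lies
within Hamming distance `1024 = 2ⁿ/4` of `b`: if `Φ(f₀,g₀) = 1` then `g₀` is bent with dual `f₀`
(Cauchy–Schwarz), `f₀` is bent, and writing `ρ = (-1)^{a + f₀}` the closeness of `g₀` to `b` reads
`∑_u (1 - ρ(u)) w(u) ≤ 28928` with `w(u) = 6^{z(u)} 2^{4-z(u)}` (`z(u)` = number of zero blocks of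
`u`), while `|W_{f₀}| ≤ 64` at the 29 points `1¹²`, `1¹² ⊕ e(k,v̄)` forces
`∑_u (1-ρ(u)) z(u) [z(u) odd] ≥ 608`, hence `∑_u (1-ρ(u)) w(u) ≥ 48 · 608 = 29184 > 28928`.
(crux-triage seat refuter-cruxtri-stmt-QuantumAdvantage-2202-r1-3-0, 2026-08-16; paper proof and
machine checks: Cruxes/CubicStability/Counterexample-P4.md, kit j007630.)

Classification: refuted-substantive for the filed constants `(3/5, 1/4)` — the witness is a genuine
'sporadic forrelated cubic pair far from every bent/dual pair'; the cheapest repair it misses is a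
YES threshold `θ > 625/1024` (e.g. `2/3`), whose truth is open.
-/

noncomputable section

open Finset
open Literature.Computability.QuantumComplexity
open Literature.Computability.QuantumComplexity.DerivativeWalsh (W)
open Literature.Computability.QuantumComplexity.BuzetChailloux (bxor twist_bxor_right signOf_sq)
open Summit.QuantumAdvantage.QuantumAdvantage.Theorems.CubicStability.Negative.P4

namespace Summit.QuantumAdvantage.QuantumAdvantage.Theorems

namespace CubicStabilityRefutation

/-! ### The refutation -/

open Summit.QuantumAdvantage.QuantumAdvantage.Theses.CubicForrelation in
/-- Refutes `CubicForrelation.CubicStability` [refuted-substantive]: the cubic pair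
`a = ∑_k [wt(x^k) = 2]`, `b = ∑_k x^k₁x^k₂x^k₃` on `n = 12` (4 blocks of 3 bits) has
`Φ = 625/1024 ≥ 3/5`, but no exactly forrelated pair `(f₀, g₀)` has `4·#{b ≠ g₀} ≤ 2¹²`
(no bent function lies within Hamming distance `2ⁿ/4` of `b`); witness above; repaired statement
missed by the witness: the same with YES threshold `2/3` (truth open). [folklore] -/
theorem cubicStability_refuted : ¬ CubicStability := by
  rw [CubicStability.Negative.cubicStability_iff]
  intro h
  obtain ⟨f₀, g₀, -, -, hex, -, hdg⟩ :=
    h (4 * 3) ⟨6, rfl⟩ fA gB isCubic_fA isCubic_gB yes_fA_gB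
  -- notation
  set sf : (Fin (4 * 3) → Bool) → ℝ := fun x => signOf (fA x) with hsf
  set sg : (Fin (4 * 3) → Bool) → ℝ := fun y => signOf (gB y) with hsg
  set sf0 : (Fin (4 * 3) → Bool) → ℝ := fun x => signOf (f₀ x) with hsf0
  set sg0 : (Fin (4 * 3) → Bool) → ℝ := fun y => signOf (g₀ y) with hsg0
  have hsf_sq : ∀ x, sf x ^ 2 = 1 := fun x => signOf_sq _
  have hsf0_sq : ∀ x, sf0 x ^ 2 = 1 := fun x => signOf_sq _
  have hsg0_sq : ∀ y, sg0 y ^ 2 = 1 := fun y => signOf_sq _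
  -- exactness ⇒ `g₀` bent with dual `f₀`, and `f₀` bent with dual `g₀`
  have hS : ∑ x, sf0 x * W sg0 x = 64 * 2 ^ (4 * 3) := by
    have e := forrelation_eq f₀ g₀
    rw [hex] at e
    have : ∑ x, signOf (f₀ x) * W (fun y => signOf (g₀ y)) x = 2 ^ 18 := by
      have h2 : (2 ^ 18 : ℝ) ≠ 0 := by positivity
      field_simp at e
      linarith
    rw [show (64 : ℝ) * 2 ^ (4 * 3) = 2 ^ 18 by norm_num]
    exact this
  have hWg0 : ∀ x, W sg0 x = 64 * sf0 x :=
    W_eq_of_fsum_eq sf0 sg0 hsf0_sq hsg0_sq 64 (by norm_num) hS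
  have hWf0 : ∀ u, W sf0 u = 64 * sg0 u := W_dual sf0 sg0 64 (by norm_num) (by norm_num) hWg0
  -- ρ = sf · sf0
  set ρ : (Fin (4 * 3) → Bool) → ℝ := fun x => sf x * sf0 x with hρ
  have hρsf : ∀ x, sf0 x = ρ x * sf x := by
    intro x
    have h1 : sf x ^ 2 = 1 := hsf_sq x
    have h2 : ρ x = sf x * sf0 x := rfl
    calc sf0 x = sf0 x * (sf x ^ 2) := by rw [h1, mul_one]
      _ = (sf x * sf0 x) * sf x := by ring
      _ = ρ x * sf x := by rw [h2]
  have hρle : ∀ x, 0 ≤ 1 - ρ x := by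
    intro x
    simp only [hρ, hsf, hsf0]
    cases fA x <;> cases f₀ x <;> norm_num [signOf]
  -- (B) closeness of `g₀` to `b`
  have hB : ∑ u, (1 - ρ u) * (sf u * W sg u) ≤ 28928 := by
    have hcorr : (2 : ℝ) ^ (4 * 3) / 2 ≤ ∑ y, sg y * sg0 y := by
      have e := two_pow_eq_corr_add gB g₀
      have hd : (4 : ℝ) * (CubicStability.Negative.hdist gB g₀ : ℝ) ≤ 2 ^ (4 * 3) := by
        exact_mod_cast hdg
      show (2 : ℝ) ^ (4 * 3) / 2 ≤ ∑ y, signOf (gB y) * signOf (g₀ y)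
      norm_num at e hd ⊢
      linarith
    have hplan := sum_W_mul_W sg sg0
    have e2 : ∑ x, W sg x * W sg0 x = 64 * ∑ x, ρ x * (sf x * W sg x) := by
      rw [mul_sum]
      refine sum_congr rfl fun x _ => ?_
      rw [hWg0 x, hρsf x]; ring
    have e3 : ∑ u, (1 - ρ u) * (sf u * W sg u) = ∑ u, sf u * W sg u - ∑ u, ρ u * (sf u * W sg u) := by
      rw [← sum_sub_distrib]; exact sum_congr rfl fun u _ => by ring
    rw [e3, show ∑ u, sf u * W sg u = 160000 from sum_w]
    have : (2 : ℝ) ^ (4 * 3) * (2 ^ (4 * 3) / 2) ≤ 64 * ∑ x, ρ x * (sf x * W sg x) := by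
      rw [← e2, hplan]
      exact mul_le_mul_of_nonneg_left hcorr (by positivity)
    norm_num at this
    linarith
  -- (X) bentness of `f₀` at `x*`
  have hX : ∑ u, (1 - ρ u) * P u ≤ 1360 := by
    have e1 : W sf0 xstar = ∑ u, ρ u * P u := by
      rw [show W sf0 xstar = ∑ u, sf0 u * twist u xstar from rfl]
      refine sum_congr rfl fun u _ => ?_
      rw [hρsf u, ← sf_twist_xstar u]; simp only [hsf]; ring
    have hb : -64 ≤ W sf0 xstar := by
      rw [hWf0]; simp only [hsg0]; nlinarith [neg_one_le_signOf (g₀ xstar)]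
    have e3 : ∑ u, (1 - ρ u) * P u = ∑ u, P u - ∑ u, ρ u * P u := by
      rw [← sum_sub_distrib]; exact sum_congr rfl fun u _ => by ring
    rw [e3, sum_P, ← e1]
    linarith
  -- (Y) bentness of `f₀` at `x* ⊕ e(k,w)`, summed over `w ≠ 0`
  have hY : ∀ k : Fin 4, ∑ u, (1 - ρ u) * P u * (if blk u k = zero3 then (1 : ℝ) else 0) ≤ -152 := by
    intro k
    have hYw : ∀ w : V, w ≠ zero3 → ∑ u, (1 - ρ u) * P u * twist (blk u k) w ≤ -368 := by
      intro w hw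
      have e1 : W sf0 (bxor xstar (emb k w)) = ∑ u, ρ u * P u * twist (blk u k) w := by
        rw [show W sf0 (bxor xstar (emb k w)) = ∑ u, sf0 u * twist u (bxor xstar (emb k w)) from rfl]
        refine sum_congr rfl fun u _ => ?_
        rw [twist_bxor_right, twist_emb, hρsf u, ← sf_twist_xstar u]; simp only [hsf]; ring
      have hb : -64 ≤ W sf0 (bxor xstar (emb k w)) := by
        rw [hWf0]; simp only [hsg0]; nlinarith [neg_one_le_signOf (g₀ (bxor xstar (emb k w)))]
      have e3 : ∑ u, (1 - ρ u) * P u * twist (blk u k) w =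
          ∑ u, P u * twist (blk u k) w - ∑ u, ρ u * P u * twist (blk u k) w := by
        rw [← sum_sub_distrib]; exact sum_congr rfl fun u _ => by ring
      rw [e3, sum_P_twist k w hw, ← e1]
      linarith
    -- sum over `w ∈ univ.erase zero3`
    have hsum : ∑ w ∈ univ.erase zero3, ∑ u, (1 - ρ u) * P u * twist (blk u k) w ≤ 7 * (-368) := by
      have hcard : (univ.erase (zero3 : V)).card = 7 := by rw [card_erase_of_mem (mem_univ _), card_univ, card_V]
      calc ∑ w ∈ univ.erase zero3, ∑ u, (1 - ρ u) * P u * twist (blk u k) w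
          ≤ ∑ w ∈ univ.erase (zero3 : V), (-368 : ℝ) :=
            sum_le_sum fun w hw => hYw w (ne_of_mem_erase hw)
        _ = 7 * (-368) := by rw [sum_const, hcard]; norm_num
    rw [sum_comm] at hsum
    have e4 : ∀ u : Fin (4 * 3) → Bool, ∑ w ∈ univ.erase zero3, (1 - ρ u) * P u * twist (blk u k) w =
        8 * ((1 - ρ u) * P u * (if blk u k = zero3 then (1 : ℝ) else 0)) - (1 - ρ u) * P u := by
      intro u
      rw [← mul_sum, sum_twist_erase]
      split_ifs <;> ring
    simp_rw [e4] at hsum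
    rw [sum_sub_distrib, ← mul_sum] at hsum
    linarith [hX]
  -- sum over the four blocks: `∑_u (1-ρ) P z ≤ -608`
  have hZ : ∑ u, (1 - ρ u) * P u * (z u : ℝ) ≤ -608 := by
    have e : ∀ u : Fin (4 * 3) → Bool, (1 - ρ u) * P u * (z u : ℝ) =
        ∑ k, (1 - ρ u) * P u * (if blk u k = zero3 then (1 : ℝ) else 0) := by
      intro u; rw [z_eq_sum, mul_sum]
    simp_rw [e]
    rw [sum_comm]
    calc ∑ k : Fin 4, ∑ u, (1 - ρ u) * P u * (if blk u k = zero3 then (1 : ℝ) else 0)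
        ≤ ∑ _k : Fin 4, (-152 : ℝ) := sum_le_sum fun k _ => hY k
      _ = -608 := by simp; norm_num
  -- pointwise pattern inequalities finish
  have hT : 608 ≤ ∑ u, (1 - ρ u) * t u := by
    have : ∑ u, -((1 - ρ u) * P u * (z u : ℝ)) ≤ ∑ u, (1 - ρ u) * t u := by
      refine sum_le_sum fun u _ => ?_
      have h1 := negPz_le u
      have h2 := hρle u
      nlinarith
    rw [sum_neg_distrib] at this
    linarith
  have hW : 48 * ∑ u, (1 - ρ u) * t u ≤ ∑ u, (1 - ρ u) * (sf u * W sg u) := by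
    rw [mul_sum]
    refine sum_le_sum fun u _ => ?_
    have h1 := w_ge u
    have h2 := hρle u
    have h3 : sf u * W sg u = ∏ k, mV (blk u k) := w_eq u
    rw [h3]
    nlinarith
  linarith

end CubicStabilityRefutation


/-- Refutes `CubicForrelation.CubicStability` [refuted-substantive]: at `n = 12` the cubic pair
`a = ∑_{k<4} [wt(x^{k}) = 2]`, `b = ∑_{k<4} x^k₁x^k₂x^k₃` (four blocks of three bits) is a YES instance,
`Φ(a,b) = 625/1024 ≥ 3/5` (Φ is multiplicative over blocks, `20/2^{4.5}` per block), yet NO bent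
function on `𝔽₂¹²` lies within Hamming distance `1024 = 2ⁿ/4` of `b` (Parseval, bentness of the dual
at the 29 Walsh points `1¹²`, `1¹² ⊕ e(k,w)`, and a weighted count), so no exactly forrelated pair
`(f₀,g₀)` satisfies `4·#{b ≠ g₀} ≤ 2¹²`; witness `(a, b)`; the repaired statement with YES threshold
`2/3` in place of `3/5` is missed by this witness (its truth is open). [folklore] -/
theorem CubicForrelationCubicStability_refuted :
    ¬ Summit.QuantumAdvantage.QuantumAdvantage.Theses.CubicForrelation.CubicStability :=
  CubicStabilityRefutation.cubicStability_refuted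

end Summit.QuantumAdvantage.QuantumAdvantage.Theorems
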